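import Summits.QuantumFields.BalabanUV.T4Continuum.Support.ShellMeasureLinearizedJacobian
import Summits.QuantumFields.BalabanUV.T4Continuum.Support.ShellMeasureLinearizedFromQ

/-!
# `T4Continuum.ShellMeasureLinearizedJacobianFixed` — (LR)_j: row S41's Jacobian ray binder with its hypothesis-style
# inputs DISCHARGED — (§1) on the CONSTRUCTED real form `E := Fix(κ_𝒴)`, `F := Fix(κ_𝒳)` of row S40, (§2) from the
# PRINTED AVERAGE `Q̃`'s four properties via row S46, (§3) both at once: E2′'s `hE` for the Jacobian term from
# NOTHING but `Q̃`'s data, the right inverse `hop`, the conjugations, a solution `D̃`, and the ray data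
(cell `pub-balaban`, sub-cell `t4`, spine estimate NE7c (node U5b); NE7c ROUND-2 crew seat
`b2b-balaban-t4-ne7c-formalise-leaf-02` gen 6 — row S41 file 3 (journal `CLAIMS.log`: «MINE» on leaf-09-g8's INFO-1,
their YIELD; the owner's table v2.0 header «f3 … folds in on landing»); ADDITIVE — imports S41 f2
`ShellMeasureLinearizedJacobian` (p217920) and S46 `ShellMeasureLinearizedFromQ` (p218633, leaf-08-g10; hence S40
`ShellMeasureLinearizedRealStructure`, p217266, leaf-09-g8) only, modifies nothing; [folklore] instantiation BY NAME;
0 `def`, 0 `def … : Prop`, 0 sorry, 0 citations)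

HONEST FRAMING.  Finite four-torus programme, rung (B)+1 only — NOT infinite volume, NOT a mass gap, NOT the Clay
problem, NOT summit progress; (B), `BetaPertHyp`, (B^μ) not consumed.  NE7c (`T4IndicatorShell.ShellWeightBound`) is
NOT PRINTED and NOT PROVED; «NE7c ⇐ the named binders» (trigger c3).  Nothing of [Balaban 1983–89] is asserted: the
substitution data of `B12JacobianReal267` (§1) resp. the printed average `Q̃` of [Balaban1987RG1] (2.4) p. 266 in S46's
hypothesis-style typing (§2–§3: `Qt` analytic on `ball 0 R`, `Qt 0 = 0`, `‖Qt‖ ≤ M_Q`, a right inverse `hop` of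
`DQ̃(0)` with `‖hop X‖ ≤ b‖X‖`, involutive conjugations with `Qt`, `hop` equivariant, `9·(2M_Q∕R²)·b·ε ≤ 1∕2`,
`3ε ≤ R`, any solution `D̃` of print's fixed-point equation for `C̃ := nonlin Qt` — one exists by S46
`exists_Dt_of_Q`) stay displayed-TYPE binders; that Bałaban's averaging-in-the-chart HAS these properties with
k-uniform constants is rows S47–S49 ∕ [dict], NOT claimed here.  HONEST DEPENDENCY (cell, verbatim): continuum YM on
T⁴ ⇐ BetaPertH ∧ nine spine estimates (0/9 proved); BetaPertH ⇐ (D1) ∧ (D4) ∧ CAP+tail; G-an2-4 gates asym, D1 and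
NE2/3/4.

CONTENTS.  §1 ON `Fix(κ)`: with `ιE := incl κY`, `πE := reP κY hκY`, `ιF := incl κX`, `πF := reP κX hκX` (S40) and
S36's real `h := πE ∘L hop↾ℝ ∘L ιF` — `det_jacobianTerm_fixed_pos`, **`hE_jacobianTerm_fixed`**: S41
`det_realForm_phi_pos` ∕ `hE_jacobianTerm` with the five real-form∕intertwining hypotheses `hιπE hιEr hπιE hιπF hh`
DISCHARGED by S40 `incl_reP_of_fixed` ∕ `conj_incl` ∕ `reP_incl` + S41 `hop_ιF_realForm` BY NAME, the window
hypothesis in `Fix(κ_𝒴)`'s own norms (`‖y₀‖ + Rad·‖Λ x‖ ≤ r < ε`, S40 `norm_incl`).  §2 FROM `Q̃`: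
`det_realForm_phi_pos_of_Q`, **`hE_jacobianTerm_of_Q`**: S41's statements with `Ct := nonlin Qt`, `C₂ := Mq R M_Q` and
the four B12 binders `hC hCa hC₂ hCt` DISCHARGED by S46 `quadAnalytic_nonlin_of_Q` ∕ `analyticOnNhd_nonlin_of_Q` ∕
`Mq_nonneg_of_Q` ∕ `nonlin_conj_of_equivariant` BY NAME.  §3 **`hE_jacobianTerm_fixed_of_Q`** — both: E2′'s `hE`
binder for `𝓔_J` on `Fix(κ_𝒴)` with constant `3·(2·dim_ℂ 𝒴·(−log(1 − 18·(2M_Q∕R²)·b·r)))∕(Rad − 1)` from `Q̃`'s data,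
`hop`, the conjugations, `D̃` and `(Λ, y₀, W, Rad, r)` ONLY.  NO new binder; NOT an instance of SM-L4 for Bałaban's
other terms; NOTHING in the countdown moves; NE7c NOT PROVED; spine PROVED 0/9.
-/

noncomputable section

open Set Metric Filter Topology

namespace Summit.QuantumFields.BalabanUV.T4Continuum.ShellMeasureLinearizedJacobianFixed

open Literature.MathematicalPhysics.QuantumFieldTheory.Balaban1983to89
open B13Contraction113 (QuadAnalytic)
open Summit.QuantumFields.BalabanUV.Beta.LinearizingChange267FromQ (nonlin Mq)
open ShellMeasureLinearizedRealStructure (realSub incl reP conj_incl incl_reP_of_fixed reP_incl norm_incl)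
open ShellMeasureLinearizedFromQ (quadAnalytic_nonlin_of_Q analyticOnNhd_nonlin_of_Q Mq_nonneg_of_Q
  nonlin_conj_of_equivariant)
open ShellMeasureLinearizedJacobian (hop_ιF_realForm det_realForm_phi_pos hE_jacobianTerm)

variable {𝒳 𝒴 : Type*} [NormedAddCommGroup 𝒳] [NormedSpace ℂ 𝒳] [CompleteSpace 𝒳]
  [NormedAddCommGroup 𝒴] [NormedSpace ℂ 𝒴] [CompleteSpace 𝒴] [FiniteDimensional ℂ 𝒴]
  {hop : 𝒳 →ₗ[ℂ] 𝒴} {Ct : 𝒴 → 𝒳} {C₂ R b ε : ℝ} {Dt : 𝒴 → 𝒳} {Qt : 𝒴 → 𝒳} {MQ : ℝ}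
  {κX : 𝒳 ≃ₗᵢ⋆[ℂ] 𝒳} {κY : 𝒴 ≃ₗᵢ⋆[ℂ] 𝒴}

/-! ## §1 On the constructed real form `Fix(κ)` -/

/-- **THE REAL JACOBIAN ON THE CONSTRUCTED REAL FORM IS POSITIVE**: at every point `B ∈ Fix(κ_𝒴)` with `‖B‖ < ε`,
`0 < det (id − h ∘ (reP κ_𝒳 ∘ DD̃(B)↾ℝ ∘ incl κ_𝒴))`, `h := reP κ_𝒴 ∘ hop↾ℝ ∘ incl κ_𝒳` — S41 `det_realForm_phi_pos`
with the real form of S40. [folklore] -/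
theorem det_jacobianTerm_fixed_pos (hκX : ∀ X, κX (κX X) = X) (hκY : ∀ B, κY (κY B) = B)
    (hC : QuadAnalytic Ct C₂ R) (hCa : AnalyticOnNhd ℂ Ct {Y : 𝒴 | ‖Y‖ < R})
    (hC₂ : 0 ≤ C₂) (hb : 0 ≤ b) (hHop : ∀ X, ‖hop X‖ ≤ b * ‖X‖) (hq2 : 9 * C₂ * b * ε ≤ 1 / 2)
    (hRC : 3 * ε ≤ R) (hDball : ∀ B : 𝒴, ‖B‖ < ε → Dt B ∈ closedBall (0:𝒳) (4 * C₂ * ε ^ 2))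
    (hDfix : ∀ B : 𝒴, ‖B‖ < ε → Ct (B - hop (Dt B)) = Dt B)
    (hhop : ∀ X, hop (κX X) = κY (hop X)) (hCt : ∀ Y : 𝒴, ‖Y‖ < R → Ct (κY Y) = κX (Ct Y))
    {B : realSub κY} (hB : ‖B‖ < ε) :
    0 < (ContinuousLinearMap.id ℝ (realSub κY) -
      (reP κY hκY ∘L (hop.mkContinuous b hHop).restrictScalars ℝ ∘L incl κX) ∘L
        (reP κX hκX ∘L (fderiv ℂ Dt (incl κY B)).restrictScalars ℝ ∘L incl κY)).det :=
  det_realForm_phi_pos hC hCa hC₂ hb hHop hq2 hRC hDball hDfix hκX hκY hhop hCt (incl_reP_of_fixed hκY)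
    (conj_incl κY) (reP_incl hκY) (incl_reP_of_fixed hκX)
    (hop_ιF_realForm hHop hhop (incl_reP_of_fixed hκY) (conj_incl κX)) (by rwa [norm_incl])

/-- **E2′'s `hE` FOR THE JACOBIAN TERM ON THE CONSTRUCTED REAL FORM — FROM EXACTLY THE B12 LEAF'S BINDERS.**  For the
substitution data of `B12JacobianReal267` (involutive conjugations included), a real-linear direction map
`Λ : Kf →ₗ[ℝ] Fix(κ_𝒴)`, a base point `y₀ ∈ Fix(κ_𝒴)` and a window `W` with `‖y₀‖ + Rad·‖Λ x‖ ≤ r < ε` on `W`,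
`Rad > 1`: with `𝓔_J x := −log det (id − h ∘ (reP κ_𝒳 ∘ DD̃(y₀ + Λ x)↾ℝ ∘ incl κ_𝒴))`,
`h := reP κ_𝒴 ∘ hop↾ℝ ∘ incl κ_𝒳`, for every `x ∈ W` and `1∕2 ≤ c ≤ 1`:
`𝓔_J (c • x) ≤ 𝓔_J x + (1 − c)·(3·(2·dim_ℂ 𝒴·(−log(1 − 18C₂b·r)))∕(Rad − 1))` — S41 `hE_jacobianTerm` with its
real-form and intertwining hypotheses discharged by S40 ∕ S41 BY NAME. [folklore] -/
theorem hE_jacobianTerm_fixed (hκX : ∀ X, κX (κX X) = X) (hκY : ∀ B, κY (κY B) = B)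
    (hC : QuadAnalytic Ct C₂ R) (hCa : AnalyticOnNhd ℂ Ct {Y : 𝒴 | ‖Y‖ < R})
    (hC₂ : 0 ≤ C₂) (hb : 0 ≤ b) (hHop : ∀ X, ‖hop X‖ ≤ b * ‖X‖) (hq2 : 9 * C₂ * b * ε ≤ 1 / 2)
    (hRC : 3 * ε ≤ R) (hDball : ∀ B : 𝒴, ‖B‖ < ε → Dt B ∈ closedBall (0:𝒳) (4 * C₂ * ε ^ 2))
    (hDfix : ∀ B : 𝒴, ‖B‖ < ε → Ct (B - hop (Dt B)) = Dt B)
    (hhop : ∀ X, hop (κX X) = κY (hop X)) (hCt : ∀ Y : 𝒴, ‖Y‖ < R → Ct (κY Y) = κX (Ct Y))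
    {Kf : Type*} [AddCommGroup Kf] [Module ℝ Kf] (Λ : Kf →ₗ[ℝ] realSub κY) (y₀ : realSub κY)
    {W : Set Kf} {Rad r : ℝ} (hRad : 1 < Rad) (hW : ∀ x ∈ W, ‖y₀‖ + Rad * ‖Λ x‖ ≤ r) (hrε : r < ε) :
    ∀ x ∈ W, ∀ c : ℝ, 1 / 2 ≤ c → c ≤ 1 →
      (fun x : Kf => -Real.log (ContinuousLinearMap.id ℝ (realSub κY) -
          (reP κY hκY ∘L (hop.mkContinuous b hHop).restrictScalars ℝ ∘L incl κX) ∘L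
            (reP κX hκX ∘L (fderiv ℂ Dt (incl κY (y₀ + Λ x))).restrictScalars ℝ ∘L incl κY)).det) (c • x) ≤
        (fun x : Kf => -Real.log (ContinuousLinearMap.id ℝ (realSub κY) -
          (reP κY hκY ∘L (hop.mkContinuous b hHop).restrictScalars ℝ ∘L incl κX) ∘L
            (reP κX hκX ∘L (fderiv ℂ Dt (incl κY (y₀ + Λ x))).restrictScalars ℝ ∘L incl κY)).det) x +
          (1 - c) * (3 * (2 * (Module.finrank ℂ 𝒴 * (-Real.log (1 - 18 * C₂ * b * r)))) / (Rad - 1)) :=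
  hE_jacobianTerm hC hCa hC₂ hb hHop hq2 hRC hDball hDfix hκX hκY hhop hCt (incl_reP_of_fixed hκY) (conj_incl κY)
    (reP_incl hκY) (incl_reP_of_fixed hκX) (hop_ιF_realForm hHop hhop (incl_reP_of_fixed hκY) (conj_incl κX)) Λ y₀
    hRad (fun x hx => by rw [norm_incl, norm_incl]; exact hW x hx) hrε

/-! ## §2 From the printed average `Q̃` (row S46), hypothesis-style real form -/

section FromQ

variable {E F : Type*} [NormedAddCommGroup E] [NormedSpace ℝ E] [NormedAddCommGroup F] [NormedSpace ℝ F]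
  {ιE : E →L[ℝ] 𝒴} {πE : 𝒴 →L[ℝ] E} {ιF : F →L[ℝ] 𝒳} {πF : 𝒳 →L[ℝ] F} {h : F →L[ℝ] E}

/-- **POSITIVITY OF THE REAL JACOBIAN, FROM `Q̃`**: S41 `det_realForm_phi_pos` with `C̃ := Q̃ − DQ̃(0)`,
`C₂ := 2M_Q∕R²` and its four B12 binders discharged by S46. [folklore] -/
theorem det_realForm_phi_pos_of_Q (hR : 0 < R) (hQa : AnalyticOnNhd ℂ Qt (ball 0 R))
    (hQM : ∀ B ∈ ball (0 : 𝒴) R, ‖Qt B‖ ≤ MQ) (hQ0 : Qt 0 = 0)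
    (hb : 0 ≤ b) (hHop : ∀ X, ‖hop X‖ ≤ b * ‖X‖) (hq2 : 9 * Mq R MQ * b * ε ≤ 1 / 2) (hRC : 3 * ε ≤ R)
    (hDball : ∀ B : 𝒴, ‖B‖ < ε → Dt B ∈ closedBall (0:𝒳) (4 * Mq R MQ * ε ^ 2))
    (hDfix : ∀ B : 𝒴, ‖B‖ < ε → nonlin Qt (B - hop (Dt B)) = Dt B)
    (hκX : ∀ X, κX (κX X) = X) (hκY : ∀ B, κY (κY B) = B)
    (hhop : ∀ X, hop (κX X) = κY (hop X)) (hQt : ∀ B ∈ ball (0 : 𝒴) R, Qt (κY B) = κX (Qt B))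
    (hιπE : ∀ B, κY B = B → ιE (πE B) = B) (hιEr : ∀ y, κY (ιE y) = ιE y) (hπιE : ∀ y, πE (ιE y) = y)
    (hιπF : ∀ X, κX X = X → ιF (πF X) = X) (hh : ∀ x, hop (ιF x) = ιE (h x))
    {B : E} (hB : ‖ιE B‖ < ε) :
    0 < (ContinuousLinearMap.id ℝ E - h ∘L (πF ∘L (fderiv ℂ Dt (ιE B)).restrictScalars ℝ ∘L ιE)).det :=
  det_realForm_phi_pos (quadAnalytic_nonlin_of_Q hR hQa hQM hQ0) (analyticOnNhd_nonlin_of_Q hQa)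
    (Mq_nonneg_of_Q hR hQM) hb hHop hq2 hRC hDball hDfix hκX hκY hhop (nonlin_conj_of_equivariant hR hQa hQt) hιπE
    hιEr hπιE hιπF hh hB

/-- **S41's `hE` FOR THE JACOBIAN TERM, FROM `Q̃`**: in the fibre coordinate (charted point `y₀ + Λ x`), for `x ∈ W`
with `‖ιE y₀‖ + Rad·‖ιE (Λ x)‖ ≤ r < ε`, `Rad > 1`, `1∕2 ≤ c ≤ 1`:
`𝓔_J (c • x) ≤ 𝓔_J x + (1 − c)·(3·(2·dim_ℂ 𝒴·(−log(1 − 18·C₂·b·r)))∕(Rad − 1))`, `C₂ = Mq R M_Q = 2M_Q∕R²`,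
`𝓔_J x := −log det (id − h ∘ (πF ∘ DD̃(ιE (y₀ + Λ x))↾ℝ ∘ ιE))` — S41 `hE_jacobianTerm` with `hC hCa hC₂ hCt`
discharged by S46. [folklore] -/
theorem hE_jacobianTerm_of_Q (hR : 0 < R) (hQa : AnalyticOnNhd ℂ Qt (ball 0 R))
    (hQM : ∀ B ∈ ball (0 : 𝒴) R, ‖Qt B‖ ≤ MQ) (hQ0 : Qt 0 = 0)
    (hb : 0 ≤ b) (hHop : ∀ X, ‖hop X‖ ≤ b * ‖X‖) (hq2 : 9 * Mq R MQ * b * ε ≤ 1 / 2) (hRC : 3 * ε ≤ R)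
    (hDball : ∀ B : 𝒴, ‖B‖ < ε → Dt B ∈ closedBall (0:𝒳) (4 * Mq R MQ * ε ^ 2))
    (hDfix : ∀ B : 𝒴, ‖B‖ < ε → nonlin Qt (B - hop (Dt B)) = Dt B)
    (hκX : ∀ X, κX (κX X) = X) (hκY : ∀ B, κY (κY B) = B)
    (hhop : ∀ X, hop (κX X) = κY (hop X)) (hQt : ∀ B ∈ ball (0 : 𝒴) R, Qt (κY B) = κX (Qt B))
    (hιπE : ∀ B, κY B = B → ιE (πE B) = B) (hιEr : ∀ y, κY (ιE y) = ιE y) (hπιE : ∀ y, πE (ιE y) = y)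
    (hιπF : ∀ X, κX X = X → ιF (πF X) = X) (hh : ∀ x, hop (ιF x) = ιE (h x))
    {Kf : Type*} [AddCommGroup Kf] [Module ℝ Kf] (Λ : Kf →ₗ[ℝ] E) (y₀ : E) {W : Set Kf} {Rad r : ℝ}
    (hRad : 1 < Rad) (hW : ∀ x ∈ W, ‖ιE y₀‖ + Rad * ‖ιE (Λ x)‖ ≤ r) (hrε : r < ε) :
    ∀ x ∈ W, ∀ c : ℝ, 1 / 2 ≤ c → c ≤ 1 →
      (fun x : Kf => -Real.log (ContinuousLinearMap.id ℝ E -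
          h ∘L (πF ∘L (fderiv ℂ Dt (ιE (y₀ + Λ x))).restrictScalars ℝ ∘L ιE)).det) (c • x) ≤
        (fun x : Kf => -Real.log (ContinuousLinearMap.id ℝ E -
          h ∘L (πF ∘L (fderiv ℂ Dt (ιE (y₀ + Λ x))).restrictScalars ℝ ∘L ιE)).det) x +
          (1 - c) * (3 * (2 * (Module.finrank ℂ 𝒴 * (-Real.log (1 - 18 * Mq R MQ * b * r)))) / (Rad - 1)) :=
  hE_jacobianTerm (quadAnalytic_nonlin_of_Q hR hQa hQM hQ0) (analyticOnNhd_nonlin_of_Q hQa) (Mq_nonneg_of_Q hR hQM)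
    hb hHop hq2 hRC hDball hDfix hκX hκY hhop (nonlin_conj_of_equivariant hR hQa hQt) hιπE hιEr hπιE hιπF hh Λ y₀
    hRad hW hrε

end FromQ

/-! ## §3 Both: the Jacobian term's `hE` on `Fix(κ)` from `Q̃`'s data alone -/

/-- **E2′'s `hE` FOR THE JACOBIAN TERM — FROM `Q̃`'S DATA ALONE, ON `Fix(κ)`.**  For `Q̃` analytic on `ball 0 R`
with `Q̃(0) = 0`, `‖Q̃‖ ≤ M_Q`, equivariant; a right inverse `hop` of `DQ̃(0)` (`‖hop‖ ≤ b`, equivariant); involutive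
conjugations; `9·(2M_Q∕R²)·b·ε ≤ 1∕2`, `3ε ≤ R`; any solution `D̃` of `C̃(B − hop D̃B) = D̃B` on `‖B‖ < ε`
(`C̃ := nonlin Qt`; one exists by S46 `exists_Dt_of_Q`); a real-linear direction map `Λ : Kf →ₗ[ℝ] Fix(κ_𝒴)`, base
point `y₀`, window `W` with `‖y₀‖ + Rad·‖Λ x‖ ≤ r < ε`, `Rad > 1`: with `h := reP κ_𝒴 ∘ hop↾ℝ ∘ incl κ_𝒳` and
`𝓔_J x := −log det (id − h ∘ (reP κ_𝒳 ∘ DD̃(y₀ + Λ x)↾ℝ ∘ incl κ_𝒴))`, for `x ∈ W`, `1∕2 ≤ c ≤ 1`: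
`𝓔_J (c • x) ≤ 𝓔_J x + (1 − c)·(3·(2·dim_ℂ 𝒴·(−log(1 − 18·(2M_Q∕R²)·b·r)))∕(Rad − 1))`. [folklore] -/
theorem hE_jacobianTerm_fixed_of_Q (hκX : ∀ X, κX (κX X) = X) (hκY : ∀ B, κY (κY B) = B)
    (hR : 0 < R) (hQa : AnalyticOnNhd ℂ Qt (ball 0 R))
    (hQM : ∀ B ∈ ball (0 : 𝒴) R, ‖Qt B‖ ≤ MQ) (hQ0 : Qt 0 = 0)
    (hb : 0 ≤ b) (hHop : ∀ X, ‖hop X‖ ≤ b * ‖X‖) (hq2 : 9 * Mq R MQ * b * ε ≤ 1 / 2) (hRC : 3 * ε ≤ R)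
    (hDball : ∀ B : 𝒴, ‖B‖ < ε → Dt B ∈ closedBall (0:𝒳) (4 * Mq R MQ * ε ^ 2))
    (hDfix : ∀ B : 𝒴, ‖B‖ < ε → nonlin Qt (B - hop (Dt B)) = Dt B)
    (hhop : ∀ X, hop (κX X) = κY (hop X)) (hQt : ∀ B ∈ ball (0 : 𝒴) R, Qt (κY B) = κX (Qt B))
    {Kf : Type*} [AddCommGroup Kf] [Module ℝ Kf] (Λ : Kf →ₗ[ℝ] realSub κY) (y₀ : realSub κY)
    {W : Set Kf} {Rad r : ℝ} (hRad : 1 < Rad) (hW : ∀ x ∈ W, ‖y₀‖ + Rad * ‖Λ x‖ ≤ r) (hrε : r < ε) :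
    ∀ x ∈ W, ∀ c : ℝ, 1 / 2 ≤ c → c ≤ 1 →
      (fun x : Kf => -Real.log (ContinuousLinearMap.id ℝ (realSub κY) -
          (reP κY hκY ∘L (hop.mkContinuous b hHop).restrictScalars ℝ ∘L incl κX) ∘L
            (reP κX hκX ∘L (fderiv ℂ Dt (incl κY (y₀ + Λ x))).restrictScalars ℝ ∘L incl κY)).det) (c • x) ≤
        (fun x : Kf => -Real.log (ContinuousLinearMap.id ℝ (realSub κY) -
          (reP κY hκY ∘L (hop.mkContinuous b hHop).restrictScalars ℝ ∘L incl κX) ∘L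
            (reP κX hκX ∘L (fderiv ℂ Dt (incl κY (y₀ + Λ x))).restrictScalars ℝ ∘L incl κY)).det) x +
          (1 - c) * (3 * (2 * (Module.finrank ℂ 𝒴 * (-Real.log (1 - 18 * Mq R MQ * b * r)))) / (Rad - 1)) :=
  hE_jacobianTerm_of_Q hR hQa hQM hQ0 hb hHop hq2 hRC hDball hDfix hκX hκY hhop hQt (incl_reP_of_fixed hκY)
    (conj_incl κY) (reP_incl hκY) (incl_reP_of_fixed hκX)
    (hop_ιF_realForm hHop hhop (incl_reP_of_fixed hκY) (conj_incl κX)) Λ y₀ hRad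
    (fun x hx => by rw [norm_incl, norm_incl]; exact hW x hx) hrε

end Summit.QuantumFields.BalabanUV.T4Continuum.ShellMeasureLinearizedJacobianFixed

end
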